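import Summits.BirchSwinnertonDyer.BirchSwinnertonDyer.Theorems.GenusKolyvaginAtTwoGenusPrimitiveSupplyAtTwoTwinSupply
import Literature.NumberTheory.EllipticCurves.MazurRubin2010.TwistSelmerRankLowering
import Literature.NumberTheory.EllipticCurves.PAdicLFunctionQuadraticTwistBirchProofs
import Literature.NumberTheory.EllipticCurves.CaiShuTian2014.HeegnerConditionProofs
import Literature.NumberTheory.EllipticCurves.ManinConstantQuadraticTwistClassCertificate
import Literature.NumberTheory.EllipticCurves.ModularityVersionApProofs
import Summits.BirchSwinnertonDyer.BirchSwinnertonDyer.Theorems.GenusKolyvaginAtTwoGenusPrimitiveSupplyAtTwoTwinSupplyEll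

/-!
# Route `GenusKolyvaginAtTwo`, crux `GenusPrimitiveSupplyAtTwo` (stmt-BirchSwinnertonDyer-22136), line `genus-supply`:
# stub A modulo four NAMED print facts and the `2`-converse (crux 19220 by name where typed)

Prover seat bsd-line-gk2-p5 (g0, 2026-08-28), cell `bsd-f1-sign2`. Companion of
`GenusKolyvaginAtTwoGenusPrimitiveSupplyAtTwoTwinSupply.lean` (same seat, p591445), where the Mazur–Rubin lowering step
was the binder `hMR`. That binder is now the tree's statement-only Literature fact
`Literature.NumberTheory.EllipticCurves.MazurRubin2010.prop52_rat` (file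
`Literature/NumberTheory/EllipticCurves/MazurRubin2010/TwistSelmerRankLowering.lean`, p591647; Mazur–Rubin 2010,
Invent. Math. 181, Prop. 5.2 over `ℚ` in the form its proof gives: «`E(ℚ)[2] = 0`, `#Sel₂(E) = 2^s`, `s > 1` ⟹ for
every `m ≠ 0` a prime `p ≡ 1 (mod m)` with `#Sel₂(E^{(p)}) = 2^{s−2}`»), whose body is `hMR` verbatim. Hence:

* `minimalSelmerTwinSupply_of_prop52`: (SUPPLY) — the hypothesis `hsupply` of the LEAD's
  `stub_minimalTwinSupplyAtTwo_of_twoConverse` — from the four NAMED PRINT FACTS `exists_isNewformOf` (BCDT 2001),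
  `p_parity · 2` (Dokchitser–Dokchitser 2010), `exists_casselsTate_pairing` (Cassels 1962), `MazurRubin2010.prop52_rat`;
* `stub_minimalTwinSupplyAtTwo_of_prop52_of_twoConverse`: the registered stub A `stub_minimalTwinSupplyAtTwo` VERBATIM
  from those four named facts and the rank-one `2`-converse (CONV₂; OPEN, crux 19220 of route `TwoAdicConverse`,
  here without its reduction-type clause).

* `goodOrd_or_mult_two_twin` (§2): the supplied twin INHERITS «good ordinary or multiplicative at `2`» from `E` — `d_K` is
  an odd fundamental discriminant prime to `N_E`, so `N_{Wd} = N_E d_K²` (tree `conductorNorm_twist_eq`, Atkin–Lehner via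
  Modularity) and `a₂(Wd) = (2/|d_K|)·a₂(E)` (tree `hasGoodReductionAtPrime_twist_and_frobeniusTrace_eq`);
* `stub_minimalTwinSupplyAtTwo_goodOrdOrMult_of_prop52_of_rankOneTwoConverse` (§3): on the «good ordinary or multiplicative
  at `2`» part of the A-class, stub A's conclusion from the four named print facts and the tree's typed crux
  `Theses.TwoAdicConverse.RankOneTwoConverse` (stmt-BirchSwinnertonDyer-19220) BY NAME.

TRUST BASE of stub A after this file: {BCDT, DD `2`-parity, Cassels–Tate, Mazur–Rubin 2010 Prop. 5.2} (print, by name)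
+ CONV₂ (open; = crux 19220 by name on the good-ordinary-or-multiplicative-at-`2` cells, binder elsewhere). No summit and
no leaf is proved by this file; BSD is not proved by any of this.
-/

set_option linter.dupNamespace false -- tree convention: `Summit.BirchSwinnertonDyer.BirchSwinnertonDyer.Theorems` (summit = sub-problem)

noncomputable section

open scoped AddSubgroup

namespace Summit.BirchSwinnertonDyer.BirchSwinnertonDyer.Theorems.GenusKoly

open NumberField WeierstrassCurve Literature.NumberTheory.EllipticCurves
  Literature.NumberTheory.EllipticCurves.ModularForms Literature.NumberTheory.QuadraticFields

/-- **(SUPPLY) modulo four NAMED PRINT FACTS**: `exists_isNewformOf` (BCDT 2001) ∧ `p_parity · 2` (Dokchitser–Dokchitser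
2010) ∧ `exists_casselsTate_pairing` (Cassels 1962) ∧ `MazurRubin2010.prop52_rat` (Mazur–Rubin 2010 Prop. 5.2, proof
form over `ℚ`) ⟹ the hypothesis `hsupply` of `stub_minimalTwinSupplyAtTwo_of_twoConverse`, verbatim
(`minimalSelmerTwinSupply_of_lowering` with `hMR := prop52_rat`). [cite: MazurRubin2010, Prop. 5.2 (proof) with Lemma 3.6] -/
theorem minimalSelmerTwinSupply_of_prop52 (hmod : exists_isNewformOf)
    (hpar : ∀ V : WeierstrassCurve ℚ, p_parity V 2) (hCT : exists_casselsTate_pairing (K := ℚ))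
    (hMR : Literature.NumberTheory.EllipticCurves.MazurRubin2010.prop52_rat) :
    ∀ (W : WeierstrassCurve ℚ) [W.IsElliptic] [W.IsGloballyMinimal] [NeZero (W.conductorNorm ℤ)],
      ¬ W.HasCM → W.analyticRank = 0 → (∀ n : ℕ, 0 < n → W.HasSurjectiveModNGaloisRep ((2 : ℤ) ^ n)) →
      ∃ (K : Type) (_ : Field K) (_ : NumberField K),
        IsImaginaryQuadratic K ∧ Odd (NumberField.discr K) ∧ NumberField.discr K ≠ -3 ∧
        SatisfiesHeegnerHypothesis (W.conductorNorm ℤ) K ∧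
        ¬ IsSquare ((NumberField.discr K : ℚ) * -|W.Δ|) ∧ ¬ IsSquare ((NumberField.discr K : ℚ) * (-(2 * |W.Δ|))) ∧
        ∃ (Wd : WeierstrassCurve ℚ) (_ : Wd.IsElliptic) (_ : Wd.IsGloballyMinimal),
          (∃ C : WeierstrassCurve.VariableChange ℚ, C • W.quadraticTwist (NumberField.discr K : ℚ) = Wd) ∧
          Nat.card (Wd.selmerGroup 2) = 2 :=
  minimalSelmerTwinSupply_of_lowering hmod hpar hCT hMR

/-- **STUB A modulo four named PRINT facts and the `2`-converse.** The registered stub `stub_minimalTwinSupplyAtTwo` of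
line `genus-supply` (crux stmt-BirchSwinnertonDyer-22136) VERBATIM from `exists_isNewformOf`, `p_parity · 2`,
`exists_casselsTate_pairing`, `MazurRubin2010.prop52_rat` (all PRINT, by name) and the rank-one `2`-converse `hconv`
(OPEN; crux 19220 of route `TwoAdicConverse` without its reduction-type clause): so the only non-print input of stub A is
the `2`-converse. BSD is not proved by any of this. [cite: MazurRubin2010, Prop. 5.2 (proof) with Lemma 3.6]
[cite: DokchitserDokchitserAnnals2010, Thm. 1.4] -/
theorem stub_minimalTwinSupplyAtTwo_of_prop52_of_twoConverse (hmod : exists_isNewformOf)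
    (hpar : ∀ V : WeierstrassCurve ℚ, p_parity V 2) (hCT : exists_casselsTate_pairing (K := ℚ))
    (hMR : Literature.NumberTheory.EllipticCurves.MazurRubin2010.prop52_rat)
    (hconv : ∀ (V : WeierstrassCurve ℚ) [V.IsElliptic] [V.IsGloballyMinimal],
      ¬ V.HasCM → V.selmerCorank 2 = 1 → V.analyticRank = 1) :
    ∀ (W : WeierstrassCurve ℚ) [W.IsElliptic] [W.IsGloballyMinimal] [NeZero (W.conductorNorm ℤ)],
      ¬ W.HasCM → W.analyticRank = 0 → (∀ n : ℕ, 0 < n → W.HasSurjectiveModNGaloisRep ((2 : ℤ) ^ n)) →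
      ∃ (K : Type) (_ : Field K) (_ : NumberField K),
        IsImaginaryQuadratic K ∧ Odd (NumberField.discr K) ∧ NumberField.discr K ≠ -3 ∧
        SatisfiesHeegnerHypothesis (W.conductorNorm ℤ) K ∧
        ¬ IsSquare ((NumberField.discr K : ℚ) * -|W.Δ|) ∧ ¬ IsSquare ((NumberField.discr K : ℚ) * (-(2 * |W.Δ|))) ∧
        ∃ (Wd : WeierstrassCurve ℚ) (_ : Wd.IsElliptic) (_ : Wd.IsGloballyMinimal),
          (∃ C : WeierstrassCurve.VariableChange ℚ, C • W.quadraticTwist (NumberField.discr K : ℚ) = Wd) ∧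
          Wd.analyticRank = 1 ∧ Nat.card (Wd.selmerGroup 2) = 2 :=
  stub_minimalTwinSupplyAtTwo_of_twoConverse hmod hpar hconv (minimalSelmerTwinSupply_of_prop52 hmod hpar hCT hMR)

/-! ## §2 The twin's reduction type at `2`: good ordinary ∕ multiplicative is inherited from `E` -/

/-- **An admissible Heegner twin is good ordinary (resp. multiplicative) at `2` when `E` is.** For `W` globally minimal,
`K` imaginary quadratic with ODD `d_K` and the Heegner hypothesis for `N_W`, and a globally minimal `Wd ≅ W^{(d_K)}`:
`d_K ≡ 1 (mod 4)` is square-free (fundamental, `isFundamentalDiscriminant_discr`) and prime to `N_W` (every `q ∣ N_W`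
splits in `K`, so `(d_K/q) = 1 ≠ 0`), hence `N_{Wd} = N_W d_K²` (`conductorNorm_twist_eq`, Atkin–Lehner, from Modularity)
and `a₂(Wd) = (2/|d_K|)·a₂(W)` at good `2` (`hasGoodReductionAtPrime_twist_and_frobeniusTrace_eq`): good ordinary at `2`
transports (`(2/|d_K|) = ±1`), and multiplicative at `2` transports (`ord₂ N_{Wd} = ord₂ N_W = 1`). Modularity enters
only through the tree's conductor-of-twist theorem. [cite: AtkinLehner1970, §6] [cite: SilvermanAEC2009, X.2 and Exercise 10.16] -/
theorem goodOrd_or_mult_two_twin (hmod : exists_isNewformOf) (W : WeierstrassCurve ℚ) [W.IsElliptic]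
    [W.IsGloballyMinimal] [NeZero (W.conductorNorm ℤ)] (K : Type) [Field K] [NumberField K] (hK : IsImaginaryQuadratic K)
    (hodd : Odd (NumberField.discr K)) (hH : SatisfiesHeegnerHypothesis (W.conductorNorm ℤ) K)
    (Wd : WeierstrassCurve ℚ) [Wd.IsElliptic] [Wd.IsGloballyMinimal]
    (hWd : ∃ C : VariableChange ℚ, C • W.quadraticTwist (NumberField.discr K : ℚ) = Wd)
    (hred : haveI : Fact (Nat.Prime 2) := ⟨Nat.prime_two⟩
      Rank1Residual.GoodOrd W 2 ∨ Rank1Residual.Mult W 2) :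
    haveI : Fact (Nat.Prime 2) := ⟨Nat.prime_two⟩
    Rank1Residual.GoodOrd Wd 2 ∨ Rank1Residual.Mult Wd 2 := by
  haveI : Fact (Nat.Prime 2) := ⟨Nat.prime_two⟩
  have hN0 : (W.conductorNorm ℤ : ℕ) ≠ 0 := NeZero.ne _
  set d : ℤ := NumberField.discr K with hd
  -- `d ≡ 1 (mod 4)` and square-free (an odd fundamental discriminant)
  obtain ⟨hd4, hsq, -⟩ | ⟨h4, -, -⟩ := Quadratic.isFundamentalDiscriminant_discr (K := K) hK.1
  swap
  · exfalso
    obtain ⟨k, hk⟩ := hodd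
    obtain ⟨e, he⟩ := h4
    omega
  have h2d : ¬ (2 : ℤ) ∣ d := by
    intro h
    obtain ⟨e, he⟩ := h
    omega
  -- `d` is prime to `N_W`: every `q ∣ N_W` splits in `K`, so `q ∤ d_K`
  have hcopN : Nat.Coprime d.natAbs (W.conductorNorm ℤ) := by
    refine Nat.coprime_of_dvd fun q hq hqd hqN ↦ ?_
    haveI : Fact q.Prime := ⟨hq⟩
    have hqd' : (q : ℤ) ∣ d := Int.natCast_dvd.mpr hqd
    have hsplit := hH q hq hqN
    by_cases hq2 : q = 2
    · subst hq2
      exact h2d (by exact_mod_cast hqd')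
    · have hleg := (Quadratic.ncard_primesOver_eq_two_iff_legendreSym hK.1 hq2).mp hsplit
      have h0 : legendreSym q d = 0 :=
        (legendreSym.eq_zero_iff q d).mpr ((ZMod.intCast_zmod_eq_zero_iff_dvd d q).mpr hqd')
      rw [h0] at hleg
      exact zero_ne_one hleg
  have hcop : IsCoprime d (W.conductorNorm ℤ : ℤ) :=
    Int.isCoprime_iff_gcd_eq_one.mpr (by rw [Int.gcd_eq_natAbs, Int.natAbs_natCast]; exact hcopN)
  obtain ⟨C, hC⟩ := hWd
  rcases hred with hord | hmult
  · -- good ordinary: `a₂(Wd) = (2/|d|)·a₂(W)` with `(2/|d|) = ±1`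
    left
    obtain ⟨hgood, ha⟩ := hasGoodReductionAtPrime_twist_and_frobeniusTrace_eq W 2 hmod hd4 hsq hcop hC hord.1 h2d
    refine ⟨hgood, ?_⟩
    have hgcd : (2 : ℤ).gcd d.natAbs = 1 := by
      rw [Int.gcd_eq_natAbs, Int.natAbs_natCast]
      exact Nat.coprime_two_left.mpr (Int.natAbs_odd.mpr hodd)
    intro h2a
    rw [ha] at h2a
    rcases jacobiSym.eq_one_or_neg_one hgcd with hJ | hJ
    · rw [show ((2 : ℕ) : ℤ) = 2 from rfl, hJ, one_mul] at h2a
      exact hord.2 h2a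
    · rw [show ((2 : ℕ) : ℤ) = 2 from rfl, hJ, neg_one_mul, dvd_neg] at h2a
      exact hord.2 h2a
  · -- multiplicative: `N_{Wd} = N_W · d²` with `d` odd, so `ord₂ N_{Wd} = 1`
    right
    have hNd : Wd.conductorNorm ℤ = W.conductorNorm ℤ * d.natAbs ^ 2 := conductorNorm_twist_eq W hmod hd4 hsq hcop hC
    have hNd0 : (Wd.conductorNorm ℤ : ℕ) ≠ 0 := (Wd.conductorNorm_pos_holds).ne'
    have hdabs0 : d.natAbs ≠ 0 := Int.natAbs_ne_zero.mpr (fun h ↦ h2d (by rw [h]; exact dvd_zero 2))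
    have hf1 : (W.conductorNorm ℤ).factorization 2 = 1 :=
      W.factorization_conductorNorm_eq_one_of_hasMultiplicativeReductionAtPrime 2 hmult
    have hfd : (d.natAbs).factorization 2 = 0 :=
      Nat.factorization_eq_zero_of_not_dvd (fun h ↦ h2d (Int.natCast_dvd.mpr h))
    have hf : (Wd.conductorNorm ℤ).factorization 2 = 1 := by
      rw [hNd, Nat.factorization_mul hN0 (pow_ne_zero 2 hdabs0), Finsupp.add_apply, Nat.factorization_pow,
        Finsupp.smul_apply, hfd, hf1]
      simp
    have h2dvd : 2 ∣ Wd.conductorNorm ℤ := (Nat.prime_two.dvd_iff_one_le_factorization hNd0).mpr hf.ge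
    have h4 : ¬ 2 ^ 2 ∣ Wd.conductorNorm ℤ := by
      rw [Nat.prime_two.pow_dvd_iff_le_factorization hNd0, hf]
      omega
    rcases ModularForms.hasGoodReductionAtPrime_or_hasMultiplicativeReductionAtPrime_of_not_sq_dvd_conductorNorm h4
      with hg | hm
    · exact absurd hg ((Wd.dvd_conductorNorm_iff_not_hasGoodReductionAtPrime 2).mp h2dvd)
    · exact hm

/-! ## §3 Stub A on the good-ordinary-or-multiplicative-at-`2` habitat ⟸ four named print facts + crux 19220 BY NAME -/

/-- **STUB A on the «good ordinary or multiplicative at `2`» part of the A-class, modulo four named PRINT facts and crux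
19220 `TwoAdicConverse.RankOneTwoConverse` BY NAME.** For `W` globally minimal, non-CM, `r_an = 0`, `ρ_{W,2^n}` onto for
all `n ≥ 1`, AND good ordinary or multiplicative at `2`: the conclusion of the registered stub `stub_minimalTwinSupplyAtTwo`
(an admissible Heegner `K` and a globally minimal `Wd ≅ W^{(d_K)}` with `r_an(Wd) = 1`, `#Sel₂(Wd) = 2`) follows from
`exists_isNewformOf` ∧ `p_parity · 2` ∧ `exists_casselsTate_pairing` ∧ `MazurRubin2010.prop52_rat` (PRINT) and the tree's
typed crux `Summit.BirchSwinnertonDyer.BirchSwinnertonDyer.Theses.TwoAdicConverse.RankOneTwoConverse` (stmt-19220, OPEN):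
(SUPPLY) from §1, the twin inherits «good ordinary or multiplicative at `2`» (§2), and the LEAD's chain (no rational
`2`-torsion, root number `−1`, odd corank `= 1`) feeds crux 19220. On the rest of the habitat (supersingular or additive at
`2`) the `2`-converse needed is not a typed tree item (binder form: `stub_minimalTwinSupplyAtTwo_of_prop52_of_twoConverse`).
BSD is not proved by any of this. [cite: MazurRubin2010, Prop. 5.2 (proof) with Lemma 3.6]
[cite: DokchitserDokchitserAnnals2010, Thm. 1.4] [cite: AtkinLehner1970, §6] -/
theorem stub_minimalTwinSupplyAtTwo_goodOrdOrMult_of_prop52_of_rankOneTwoConverse (hmod : exists_isNewformOf)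
    (hpar : ∀ V : WeierstrassCurve ℚ, p_parity V 2) (hCT : exists_casselsTate_pairing (K := ℚ))
    (hMR : Literature.NumberTheory.EllipticCurves.MazurRubin2010.prop52_rat)
    (hconv : Summit.BirchSwinnertonDyer.BirchSwinnertonDyer.Theses.TwoAdicConverse.RankOneTwoConverse) :
    ∀ (W : WeierstrassCurve ℚ) [W.IsElliptic] [W.IsGloballyMinimal] [NeZero (W.conductorNorm ℤ)],
      ¬ W.HasCM → W.analyticRank = 0 → (∀ n : ℕ, 0 < n → W.HasSurjectiveModNGaloisRep ((2 : ℤ) ^ n)) →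
      (haveI : Fact (Nat.Prime 2) := ⟨Nat.prime_two⟩
       Rank1Residual.GoodOrd W 2 ∨ Rank1Residual.Mult W 2) →
      ∃ (K : Type) (_ : Field K) (_ : NumberField K),
        IsImaginaryQuadratic K ∧ Odd (NumberField.discr K) ∧ NumberField.discr K ≠ -3 ∧
        SatisfiesHeegnerHypothesis (W.conductorNorm ℤ) K ∧
        ¬ IsSquare ((NumberField.discr K : ℚ) * -|W.Δ|) ∧ ¬ IsSquare ((NumberField.discr K : ℚ) * (-(2 * |W.Δ|))) ∧
        ∃ (Wd : WeierstrassCurve ℚ) (_ : Wd.IsElliptic) (_ : Wd.IsGloballyMinimal),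
          (∃ C : WeierstrassCurve.VariableChange ℚ, C • W.quadraticTwist (NumberField.discr K : ℚ) = Wd) ∧
          Wd.analyticRank = 1 ∧ Nat.card (Wd.selmerGroup 2) = 2 := by
  haveI : Fact (Nat.Prime 2) := ⟨Nat.prime_two⟩
  intro W _ _ _ hcm hr0 hρ hred
  obtain ⟨K, iF, iN, hIQ, hodd, h3, hHe, hsq1, hsq2, Wd, iE, iM, hWd, hSel⟩ :=
    minimalSelmerTwinSupply_of_prop52 hmod hpar hCT hMR W hcm hr0 hρ
  refine ⟨K, iF, iN, hIQ, hodd, h3, hHe, hsq1, hsq2, Wd, iE, iM, hWd, ?_, hSel⟩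
  have hd : (NumberField.discr K : ℚ) ≠ 0 := by exact_mod_cast NumberField.discr_ne_zero K
  have hcmd : ¬ Wd.HasCM := twin_not_hasCM W hcm hd Wd hWd
  have htors := natCard_twoTorsion_twin_eq_one W (hρ 1 one_pos) hd Wd hWd
  have hw := rootNumber_twin_eq_neg_one hmod W hr0 K hIQ hHe Wd hWd
  have hco := selmerCorank_two_eq_one_of_card_selmerGroup_two Wd htors hSel
    (odd_selmerCorank_two_of_p_parity Wd (hpar Wd) hw)
  have hredd := goodOrd_or_mult_two_twin hmod W K hIQ hodd hHe Wd hWd hred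
  exact hconv Wd hcmd hredd hco

/-! ## R-128 retype (director-bsd 2026-08-29 17:42Z, T-Q381-1′; seat bsd-line-gk2-p2 g21): PRINT-FORM TWINS
Every theorem below is the byte-identical twin of the theorem of the same name without the trailing prime, with the ONE change
that the `2`-parity hypothesis is typed as print has it — `∀ (V : WeierstrassCurve ℚ) [V.IsElliptic], p_parity V 2`
(Dokchitser–Dokchitser 2010 Thm. 1.4, elliptic curves; = route item `TwoParityDD` after rev 34) — instead of the bare closure
`∀ V : WeierstrassCurve ℚ, p_parity V 2` over all Weierstrass cubics (singular ones included: off print, undischargeable).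
Calls to other retyped theorems go to their primed twins; every application `hpar W` is at an elliptic curve, so the proofs are
unchanged. The unprimed originals are kept (append-only tree) and are superseded by these. BSD is NOT proved by any of this. -/

/-- **R-128 retype** (director-bsd 2026-08-29, T-Q381-1′) of `minimalSelmerTwinSupply_of_prop52`: the SAME statement and proof with the `2`-parity hypothesis in PRINT form `∀ (V : WeierstrassCurve ℚ) [V.IsElliptic], p_parity V 2` (Dokchitser–Dokchitser 2010 Thm. 1.4 is about elliptic curves; the bare closure over all Weierstrass cubics was off print). **(SUPPLY) modulo four NAMED PRINT FACTS**: `exists_isNewformOf` (BCDT 2001) ∧ `p_parity · 2` (Dokchitser–Dokchitser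
2010) ∧ `exists_casselsTate_pairing` (Cassels 1962) ∧ `MazurRubin2010.prop52_rat` (Mazur–Rubin 2010 Prop. 5.2, proof
form over `ℚ`) ⟹ the hypothesis `hsupply` of `stub_minimalTwinSupplyAtTwo_of_twoConverse'`, verbatim
(`minimalSelmerTwinSupply_of_lowering'` with `hMR := prop52_rat`). [cite: MazurRubin2010, Prop. 5.2 (proof) with Lemma 3.6] -/
theorem minimalSelmerTwinSupply_of_prop52' (hmod : exists_isNewformOf)
    (hpar : ∀ (V : WeierstrassCurve ℚ) [V.IsElliptic], p_parity V 2) (hCT : exists_casselsTate_pairing (K := ℚ))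
    (hMR : Literature.NumberTheory.EllipticCurves.MazurRubin2010.prop52_rat) :
    ∀ (W : WeierstrassCurve ℚ) [W.IsElliptic] [W.IsGloballyMinimal] [NeZero (W.conductorNorm ℤ)],
      ¬ W.HasCM → W.analyticRank = 0 → (∀ n : ℕ, 0 < n → W.HasSurjectiveModNGaloisRep ((2 : ℤ) ^ n)) →
      ∃ (K : Type) (_ : Field K) (_ : NumberField K),
        IsImaginaryQuadratic K ∧ Odd (NumberField.discr K) ∧ NumberField.discr K ≠ -3 ∧
        SatisfiesHeegnerHypothesis (W.conductorNorm ℤ) K ∧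
        ¬ IsSquare ((NumberField.discr K : ℚ) * -|W.Δ|) ∧ ¬ IsSquare ((NumberField.discr K : ℚ) * (-(2 * |W.Δ|))) ∧
        ∃ (Wd : WeierstrassCurve ℚ) (_ : Wd.IsElliptic) (_ : Wd.IsGloballyMinimal),
          (∃ C : WeierstrassCurve.VariableChange ℚ, C • W.quadraticTwist (NumberField.discr K : ℚ) = Wd) ∧
          Nat.card (Wd.selmerGroup 2) = 2 :=
  minimalSelmerTwinSupply_of_lowering' hmod hpar hCT hMR

/-- **R-128 retype** (director-bsd 2026-08-29, T-Q381-1′) of `stub_minimalTwinSupplyAtTwo_of_prop52_of_twoConverse`: the SAME statement and proof with the `2`-parity hypothesis in PRINT form `∀ (V : WeierstrassCurve ℚ) [V.IsElliptic], p_parity V 2` (Dokchitser–Dokchitser 2010 Thm. 1.4 is about elliptic curves; the bare closure over all Weierstrass cubics was off print). **STUB A modulo four named PRINT facts and the `2`-converse.** The registered stub `stub_minimalTwinSupplyAtTwo` of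
line `genus-supply` (crux stmt-BirchSwinnertonDyer-22136) VERBATIM from `exists_isNewformOf`, `p_parity · 2`,
`exists_casselsTate_pairing`, `MazurRubin2010.prop52_rat` (all PRINT, by name) and the rank-one `2`-converse `hconv`
(OPEN; crux 19220 of route `TwoAdicConverse` without its reduction-type clause): so the only non-print input of stub A is
the `2`-converse. BSD is not proved by any of this. [cite: MazurRubin2010, Prop. 5.2 (proof) with Lemma 3.6]
[cite: DokchitserDokchitserAnnals2010, Thm. 1.4] -/
theorem stub_minimalTwinSupplyAtTwo_of_prop52_of_twoConverse' (hmod : exists_isNewformOf)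
    (hpar : ∀ (V : WeierstrassCurve ℚ) [V.IsElliptic], p_parity V 2) (hCT : exists_casselsTate_pairing (K := ℚ))
    (hMR : Literature.NumberTheory.EllipticCurves.MazurRubin2010.prop52_rat)
    (hconv : ∀ (V : WeierstrassCurve ℚ) [V.IsElliptic] [V.IsGloballyMinimal],
      ¬ V.HasCM → V.selmerCorank 2 = 1 → V.analyticRank = 1) :
    ∀ (W : WeierstrassCurve ℚ) [W.IsElliptic] [W.IsGloballyMinimal] [NeZero (W.conductorNorm ℤ)],
      ¬ W.HasCM → W.analyticRank = 0 → (∀ n : ℕ, 0 < n → W.HasSurjectiveModNGaloisRep ((2 : ℤ) ^ n)) →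
      ∃ (K : Type) (_ : Field K) (_ : NumberField K),
        IsImaginaryQuadratic K ∧ Odd (NumberField.discr K) ∧ NumberField.discr K ≠ -3 ∧
        SatisfiesHeegnerHypothesis (W.conductorNorm ℤ) K ∧
        ¬ IsSquare ((NumberField.discr K : ℚ) * -|W.Δ|) ∧ ¬ IsSquare ((NumberField.discr K : ℚ) * (-(2 * |W.Δ|))) ∧
        ∃ (Wd : WeierstrassCurve ℚ) (_ : Wd.IsElliptic) (_ : Wd.IsGloballyMinimal),
          (∃ C : WeierstrassCurve.VariableChange ℚ, C • W.quadraticTwist (NumberField.discr K : ℚ) = Wd) ∧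
          Wd.analyticRank = 1 ∧ Nat.card (Wd.selmerGroup 2) = 2 :=
  stub_minimalTwinSupplyAtTwo_of_twoConverse' hmod hpar hconv (minimalSelmerTwinSupply_of_prop52' hmod hpar hCT hMR)

/-- **R-128 retype** (director-bsd 2026-08-29, T-Q381-1′) of `stub_minimalTwinSupplyAtTwo_goodOrdOrMult_of_prop52_of_rankOneTwoConverse`: the SAME statement and proof with the `2`-parity hypothesis in PRINT form `∀ (V : WeierstrassCurve ℚ) [V.IsElliptic], p_parity V 2` (Dokchitser–Dokchitser 2010 Thm. 1.4 is about elliptic curves; the bare closure over all Weierstrass cubics was off print). **STUB A on the «good ordinary or multiplicative at `2`» part of the A-class, modulo four named PRINT facts and crux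
19220 `TwoAdicConverse.RankOneTwoConverse` BY NAME.** For `W` globally minimal, non-CM, `r_an = 0`, `ρ_{W,2^n}` onto for
all `n ≥ 1`, AND good ordinary or multiplicative at `2`: the conclusion of the registered stub `stub_minimalTwinSupplyAtTwo`
(an admissible Heegner `K` and a globally minimal `Wd ≅ W^{(d_K)}` with `r_an(Wd) = 1`, `#Sel₂(Wd) = 2`) follows from
`exists_isNewformOf` ∧ `p_parity · 2` ∧ `exists_casselsTate_pairing` ∧ `MazurRubin2010.prop52_rat` (PRINT) and the tree's
typed crux `Summit.BirchSwinnertonDyer.BirchSwinnertonDyer.Theses.TwoAdicConverse.RankOneTwoConverse` (stmt-19220, OPEN):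
(SUPPLY) from §1, the twin inherits «good ordinary or multiplicative at `2`» (§2), and the LEAD's chain (no rational
`2`-torsion, root number `−1`, odd corank `= 1`) feeds crux 19220. On the rest of the habitat (supersingular or additive at
`2`) the `2`-converse needed is not a typed tree item (binder form: `stub_minimalTwinSupplyAtTwo_of_prop52_of_twoConverse'`).
BSD is not proved by any of this. [cite: MazurRubin2010, Prop. 5.2 (proof) with Lemma 3.6]
[cite: DokchitserDokchitserAnnals2010, Thm. 1.4] [cite: AtkinLehner1970, §6] -/
theorem stub_minimalTwinSupplyAtTwo_goodOrdOrMult_of_prop52_of_rankOneTwoConverse' (hmod : exists_isNewformOf)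
    (hpar : ∀ (V : WeierstrassCurve ℚ) [V.IsElliptic], p_parity V 2) (hCT : exists_casselsTate_pairing (K := ℚ))
    (hMR : Literature.NumberTheory.EllipticCurves.MazurRubin2010.prop52_rat)
    (hconv : Summit.BirchSwinnertonDyer.BirchSwinnertonDyer.Theses.TwoAdicConverse.RankOneTwoConverse) :
    ∀ (W : WeierstrassCurve ℚ) [W.IsElliptic] [W.IsGloballyMinimal] [NeZero (W.conductorNorm ℤ)],
      ¬ W.HasCM → W.analyticRank = 0 → (∀ n : ℕ, 0 < n → W.HasSurjectiveModNGaloisRep ((2 : ℤ) ^ n)) →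
      (haveI : Fact (Nat.Prime 2) := ⟨Nat.prime_two⟩
       Rank1Residual.GoodOrd W 2 ∨ Rank1Residual.Mult W 2) →
      ∃ (K : Type) (_ : Field K) (_ : NumberField K),
        IsImaginaryQuadratic K ∧ Odd (NumberField.discr K) ∧ NumberField.discr K ≠ -3 ∧
        SatisfiesHeegnerHypothesis (W.conductorNorm ℤ) K ∧
        ¬ IsSquare ((NumberField.discr K : ℚ) * -|W.Δ|) ∧ ¬ IsSquare ((NumberField.discr K : ℚ) * (-(2 * |W.Δ|))) ∧
        ∃ (Wd : WeierstrassCurve ℚ) (_ : Wd.IsElliptic) (_ : Wd.IsGloballyMinimal),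
          (∃ C : WeierstrassCurve.VariableChange ℚ, C • W.quadraticTwist (NumberField.discr K : ℚ) = Wd) ∧
          Wd.analyticRank = 1 ∧ Nat.card (Wd.selmerGroup 2) = 2 := by
  haveI : Fact (Nat.Prime 2) := ⟨Nat.prime_two⟩
  intro W _ _ _ hcm hr0 hρ hred
  obtain ⟨K, iF, iN, hIQ, hodd, h3, hHe, hsq1, hsq2, Wd, iE, iM, hWd, hSel⟩ :=
    minimalSelmerTwinSupply_of_prop52' hmod hpar hCT hMR W hcm hr0 hρ
  refine ⟨K, iF, iN, hIQ, hodd, h3, hHe, hsq1, hsq2, Wd, iE, iM, hWd, ?_, hSel⟩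
  have hd : (NumberField.discr K : ℚ) ≠ 0 := by exact_mod_cast NumberField.discr_ne_zero K
  have hcmd : ¬ Wd.HasCM := twin_not_hasCM W hcm hd Wd hWd
  have htors := natCard_twoTorsion_twin_eq_one W (hρ 1 one_pos) hd Wd hWd
  have hw := rootNumber_twin_eq_neg_one hmod W hr0 K hIQ hHe Wd hWd
  have hco := selmerCorank_two_eq_one_of_card_selmerGroup_two Wd htors hSel
    (odd_selmerCorank_two_of_p_parity Wd (hpar Wd) hw)
  have hredd := goodOrd_or_mult_two_twin hmod W K hIQ hodd hHe Wd hWd hred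
  exact hconv Wd hcmd hredd hco


end Summit.BirchSwinnertonDyer.BirchSwinnertonDyer.Theorems.GenusKoly

end
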